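import Summits.ResolutionOfSingularities.ResolutionOfSingularities.Theorems.HilbertSamuelEliminationCampaignW42ToricMarkedPosition

/-!
# [OURS · L1 W4.2] Toric marked monomial objects in dimension 3 — brick 7C: VECTORS AND HEIGHTS (data layer of the bridge to `cornerPuzzle`)

[OURS · L1 W4.2 · seat res-L1-s42-pv-2 gen 5] Memo `L/res-L1-s42-pv-2/CALIBRATION-W42-O2-v4.md` §4/§7.  The id-model `TState` forgets the ray
VECTORS `r ∈ ℤ³` and HEIGHTS `b(r)` of card M / `IdeasL1Idea2R8.HCone`; this file adds them back as ray-intrinsic data (`VState`), transports them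
along blow-ups by the heights law (`ρ_R = Σ_R r`, `b(ρ_R) = 1 + Σ_R b(r)`; a 1-face is the height shift), and proves the EXPONENT DICTIONARY
`a_r(v) = m · (⟨v, r⟩ − b(r))` (`= m · coord` of brick `…SigmaCornerPuzzleCore`) is preserved by every blow-up (`Dict.move`) and holds initially
(`dict_ofPosition`).  What remains for the bridge (NOT here): the fan property of reachable stages (equal vectors ⇒ same ray) and the simulation of
`HStage.blowup` / `cornerPuzzle.legal` (memo §4 B1/B2).  NOT a statement of the manuscript under review.  AI work, weaker than expert review.
No `sorry`, no new axiom.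
-/

set_option linter.dupNamespace false -- mandated namespace of this single-conjunct summit

namespace Summit.ResolutionOfSingularities.ResolutionOfSingularities.Theorems.CampaignW42.Toric

open Finset

/-- **[OURS · L1 W4.2]** A toric marked state together with the VECTOR and HEIGHT of every ray id. -/
structure VState (ι : Type) extends TState ι where
  /-- the lattice vector of the ray `r` -/
  vec : ℕ → Fin 3 → ℤ
  /-- the height `b(r) = ord_{E_r}(y)` of the ray `r` -/
  ht : ℕ → ℤ

namespace VState

variable {ι : Type}

/-- **[OURS · L1 W4.2]** Blow-up with vector/height bookkeeping: the new ray `ρ = s.next` gets `vec ρ = Σ_R vec r` and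
`ht ρ = 1 + Σ_R ht r` (heights law of card M), the underlying `TState` moves as before. -/
def move (m : ℕ) (s : VState ι) (R : Finset ℕ) : VState ι where
  toTState := s.toTState.move m R
  vec := Function.update s.vec s.next (fun i => ∑ r ∈ R, s.vec r i)
  ht := Function.update s.ht s.next (1 + ∑ r ∈ R, s.ht r)

/-- The rational «board coordinate» of generator `v` at ray `r`: `⟨v, vec r⟩ − ht r` (= `IdeasL1Idea2R8.coord` slotwise). -/
def qexpo (s : VState ι) (val : ι → Fin 3 → ℚ) (r : ℕ) (v : ι) : ℚ :=
  (∑ i, val v i * (s.vec r i : ℚ)) - (s.ht r : ℚ)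

/-- **[OURS · L1 W4.2]** The EXPONENT DICTIONARY: every integer exponent is `m` times the board coordinate. -/
def Dict (m : ℕ) (val : ι → Fin 3 → ℚ) (s : VState ι) : Prop :=
  ∀ r v, (s.expo r v : ℚ) = m * s.qexpo val r v

/-- The underlying toric state of a blow-up is the blown-up toric state. -/
theorem move_toTState (m : ℕ) (s : VState ι) (R : Finset ℕ) : (s.move m R).toTState = s.toTState.move m R := rfl

/-- Old rays keep their vectors. -/
theorem vec_move_of_ne {m : ℕ} {s : VState ι} {R : Finset ℕ} {r : ℕ} (hr : r ≠ s.next) : (s.move m R).vec r = s.vec r := by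
  simp [move, Function.update_of_ne hr]

/-- Old rays keep their heights. -/
theorem ht_move_of_ne {m : ℕ} {s : VState ι} {R : Finset ℕ} {r : ℕ} (hr : r ≠ s.next) : (s.move m R).ht r = s.ht r := by
  simp [move, Function.update_of_ne hr]

/-- The new ray's vector is the sum over the face. -/
theorem vec_move_next {m : ℕ} {s : VState ι} {R : Finset ℕ} (i : Fin 3) : (s.move m R).vec s.next i = ∑ r ∈ R, s.vec r i := by
  simp [move]

/-- The new ray's height is one plus the sum over the face. -/
theorem ht_move_next {m : ℕ} {s : VState ι} {R : Finset ℕ} : (s.move m R).ht s.next = 1 + ∑ r ∈ R, s.ht r := by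
  simp [move]

/-- Board coordinates of old rays are unchanged. -/
theorem qexpo_move_of_ne {m : ℕ} {s : VState ι} {R : Finset ℕ} (val : ι → Fin 3 → ℚ) {r : ℕ} (hr : r ≠ s.next) (v : ι) :
    (s.move m R).qexpo val r v = s.qexpo val r v := by
  unfold qexpo; rw [ht_move_of_ne hr]
  simp_rw [vec_move_of_ne hr]

/-- **The heights law in coordinates** (`gameMove_coord` of card M): the new ray's board coordinate is `Σ_R coord − 1`. -/
theorem qexpo_move_next {m : ℕ} {s : VState ι} {R : Finset ℕ} (val : ι → Fin 3 → ℚ) (v : ι) :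
    (s.move m R).qexpo val s.next v = (∑ r ∈ R, s.qexpo val r v) - 1 := by
  unfold qexpo
  rw [ht_move_next]
  simp_rw [vec_move_next]
  push_cast
  rw [Finset.sum_sub_distrib]
  have : ∑ i, val v i * ∑ r ∈ R, (s.vec r i : ℚ) = ∑ r ∈ R, ∑ i, val v i * (s.vec r i : ℚ) := by
    rw [Finset.sum_comm]
    exact Finset.sum_congr rfl (fun i _ => Finset.mul_sum _ _ _)
  rw [this]; ring

/-- **The dictionary is preserved by every blow-up.** -/
theorem Dict.move {m : ℕ} {val : ι → Fin 3 → ℚ} {s : VState ι} (h : s.Dict m val) (R : Finset ℕ) : (s.move m R).Dict m val := by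
  intro r v
  by_cases hr : r = s.next
  · subst hr
    show (((s.toTState.move m R).expo s.next v : ℤ) : ℚ) = _
    rw [TState.move_expo_next, qexpo_move_next]
    unfold TState.faceSum
    push_cast
    rw [Finset.sum_congr rfl (fun r _ => h r v), ← Finset.mul_sum]
    ring
  · show (((s.toTState.move m R).expo r v : ℤ) : ℚ) = _
    rw [TState.move_expo_of_ne hr, qexpo_move_of_ne val hr, h r v]

/-- **[OURS · L1 W4.2]** The initial vector state of a position: standard corner (`vec k = e_k`, heights `0`) over `TState.ofPosition`. -/
noncomputable def ofPosition (A : Finset (Fin 3 → ℚ)) (m : ℕ) (hm : ∀ v ∈ A, ∀ k : Fin 3, ∃ z : ℤ, (v k) * m = z) :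
    VState {v // v ∈ A} where
  toTState := TState.ofPosition A m hm
  vec := fun r i => if h : r < 3 then (if (⟨r, h⟩ : Fin 3) = i then 1 else 0) else 0
  ht := fun _ => 0

/-- The dictionary holds for the initial state of a position (with `val v = v`). -/
theorem dict_ofPosition (A : Finset (Fin 3 → ℚ)) (m : ℕ) (hm : ∀ v ∈ A, ∀ k : Fin 3, ∃ z : ℤ, (v k) * m = z) :
    (ofPosition A m hm).Dict m (fun v => v.1) := by
  intro r v
  unfold qexpo ofPosition TState.ofPosition TState.initial
  simp only
  by_cases h : r < 3
  · rw [dif_pos h]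
    simp only [dif_pos h]
    rw [TState.ofPosition_spec hm v ⟨r, h⟩]
    push_cast
    rw [Finset.sum_eq_single (⟨r, h⟩ : Fin 3)]
    · simp
      ring
    · intro i _ hi; rw [if_neg (Ne.symm hi)]; simp
    · intro hn; exact absurd (Finset.mem_univ _) hn
  · rw [dif_neg h]
    simp only [dif_neg h]
    simp

end VState

end Summit.ResolutionOfSingularities.ResolutionOfSingularities.Theorems.CampaignW42.Toric
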